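/-
Copyright (c) 2026 the pub-hodgecm-mathlib formalisation cell (harness21).  Prover seat hodgecm-mathlib-A-p12 (g24), 2026-09-02.  «S3-ram» seeding wave (LEAD F0P3a-plan (g12∕g13);
owner F0P3a-p06 (g15); (Cnt2′) chair F0P3a-p07 (g14)): organ (B-ii) «SHELL CLASS LAW» of the (α₂) TYPE-(2) line, file 2d «THE ODD-DEPTH FLIP» (⊇ ★ p847640 file 2a).
Kernel lane, `--supports stmt-HodgeConjecture-24833`.
-/
import Literature.NumberTheory.Rogawski1990.DepthZeroKappaTransferTypeTwoRamifiedShellFlipResidue   -- ★ p847640 (this seat) file 2a: `exists_toPlace_unit_near`, `valuation_lt_one_of_residue_eq_zero`; ⊇ ★ file 1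
import Literature.NumberTheory.Automorphic.UnitaryGroupInertPlaceHyperbolicBasis                    -- ★ `exists_toPlace_eq_of_galAdicCompletionMap_eq` (`σ`-fixed elements descend)
import HarnessLib

/-!
# The class-flipping similitude of a type-(2) torus of ODD discriminant depth at a tame-ramified place: `X = ι(2∕(zπ₀))·ϖ·D_ϖ⁻¹ι(g − ½t)D_ϖ`, unit multiplier
# `π₁∕π₀` of NON-SQUARE residue (Labesse–Langlands 1979 §2; Rogawski 1990 §4.9; Serre 1979 XIV §4)

Topic `NumberTheory/Rogawski1990`; namespace `Literature.NumberTheory.Automorphic.UnitaryGroup`.  THEOREMS ONLY (no definition, no instance, no notation, no named fact,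
no `sorry`); kernel lane `--supports stmt-HodgeConjecture-24833`.  Cell `pub/hodgecm-mathlib` (D-0151), crux H413; «S3-ram» (count-neutral); seat A-p12 (g24).  HONEST LABEL:
HC_CM is proved only modulo the cell's 2 remaining named inputs (hLiu418 24832, h413 24833) until rung 0 closes; nothing printed is asserted here.

THE MATHEMATICS (organ (B-ii) at ODD depth; ★ files 1∕2a treat even depth).  For a type-(2) `u ∈ U(σ_w, Φ₂)` (no root of `χ_u` in `L_w`) with (W1) descent `D_ϖuD_ϖ⁻¹ = s·ι(g)`
and ODD discriminant depth, `tr²g − 4det g = π₁z²` with `π₁` a UNIFORMISER of `L⁺_v` (★ parity lemma, odd branch): the torus `L⁺_v[g]` is RAMIFIED and its units have square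
residual norms, so the even-depth flip (★ 2a: `det g₀` of prescribed residue) is unavailable.  Instead (§2) the SCALAR `ϖ` (`σϖ = −ϖ`, `ϖ² = ι(π₀)`) contributes the multiplier
`σ(ϖ)ϖ = −ι(π₀)` and the traceless `τ := g − ½t·1` the multiplier `det τ = −¼π₁z²` (★ `formCongr_conj_diagonal_map`), so `X := ι(2∕(zπ₀))·ϖ·D_ϖ⁻¹ι(τ)D_ϖ` is a similitude
`ᵗσ(X)JX = ι(ν)J` with UNIT multiplier `ν = π₁∕π₀`, commuting with `u` and normalising `U`; and `ν` has NON-SQUARE residue — otherwise `π₁ = π₀b²` (Hensel, ★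
`exists_sq_eq_of_valued_sub_one_lt`), `ι(π₁) = (ϖ·ιb)²`, `tr²u − 4det u = (sϖ·ι(bz))²` and `χ_u` has the root `½(tr u + sϖι(bz))` in `L_w`, contradicting type (2) (local class
field theory: `N(E′^×)·N(E^×) = F^×` for the two distinct ramified quadratic extensions `E′ = F(√π₁)`, `E = L_w = F(√π₀)`).  (§1) In the odd residue field two non-squares multiply
to a square (`FiniteField.isSquare_iff`, `pow_dichotomy`), so every unit `p` is `≡ a²` or `≡ a²ν`; hence (§3) for EVERY unit `c ∈ 𝒪_w` there is a flip with `|ι(ν) − c|_w < 1`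
(`X₀ = ι(a)·1` or `ι(a)·X`) — the odd-depth twin of ★ 2a `exists_classFlip_similitude_of_unit`, feeding the parity-free class law (file 2e).

* §1 `exists_unit_sq_or_sq_mul_near` (residual dichotomy), `smul_similitude` (`ᵗσ(λX)J(λX) = λ²μ·J` for `σλ = λ`).
* §2 **`exists_classFlip_similitude_odd`** (multiplier `π₁∕π₀`, non-square residue).
* §3 **`exists_classFlip_similitude_of_unit_odd`** (prescribed residual class).

## References
* [LabesseLanglands1979] J.-P. Labesse, R. P. Langlands, *L-indistinguishability for SL(2)*, Canad. J. Math. 31 (1979): §2 pp. 7–8.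
* [Rogawski1990] J. D. Rogawski, *Automorphic Representations of Unitary Groups in Three Variables* (1990): §4.9 pp. 54–56; §3.6.
* [Serre1979] J.-P. Serre, *Local Fields*, GTM 67 (1979): Ch. XIV §4 (norm groups of ramified quadratic extensions), Ch. II §2.
-/

set_option autoImplicit false

noncomputable section

open MeasureTheory Measure Set NumberField IsDedekindDomain Matrix ValuativeRel MulAction Finset Polynomial
open scoped ValuativeRel Matrix MatrixGroups WithZero

namespace Literature.NumberTheory.Automorphic.UnitaryGroup

open Literature.NumberTheory.Rogawski1990 Literature.NumberTheory.Automorphic Literature.NumberTheory.Automorphic.IntegralReduction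
open Literature.NumberTheory.Automorphic.HermitianLatticeTree Literature.GroupTheory Literature.NumberTheory.GaloisRepresentations

/-! ## §1 The residual dichotomy `p ≡ a²` or `p ≡ a²ν`, and scalar rescaling of a similitude -/

section Residue

variable (L : Type) [Field L] [NumberField L] [IsCMField L] (v : HeightOneSpectrum (𝓞 ↥(maximalRealSubfield L)))

set_option maxHeartbeats 400000 in
omit [IsCMField L] in
/-- **RESIDUAL DICHOTOMY** (odd residue characteristic): for a unit `ν` of NON-SQUARE residue and any unit `p` there is a unit `a` with `p ≡ a²` or `p ≡ a²ν (mod 𝔭_v)` — the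
squares have index `2` in `𝓀^×` (Euler's criterion `FiniteField.isSquare_iff` ∕ `pow_dichotomy`: two non-squares multiply to a square). [cite: Serre1979, Ch. XIV §4] -/
theorem exists_unit_sq_or_sq_mul_near (h2 : Valued.v (2 : (v.adicCompletion ↥(maximalRealSubfield L))) = 1)
    {ν : (v.adicCompletion ↥(maximalRealSubfield L))} (hν : valuation (v.adicCompletion ↥(maximalRealSubfield L)) ν = 1)
    (hns : ∀ y : (v.adicCompletion ↥(maximalRealSubfield L)), y ∈ 𝒪[(v.adicCompletion ↥(maximalRealSubfield L))] → valuation (v.adicCompletion ↥(maximalRealSubfield L)) (y ^ 2 - ν) = 1)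
    {p : (v.adicCompletion ↥(maximalRealSubfield L))} (hp : valuation (v.adicCompletion ↥(maximalRealSubfield L)) p = 1) :
    ∃ a : (v.adicCompletion ↥(maximalRealSubfield L)), valuation (v.adicCompletion ↥(maximalRealSubfield L)) a = 1 ∧
      (valuation (v.adicCompletion ↥(maximalRealSubfield L)) (a ^ 2 - p) < 1 ∨ valuation (v.adicCompletion ↥(maximalRealSubfield L)) (a ^ 2 * ν - p) < 1) := by
  classical
  haveI := finite_residueField_integer_adicCompletion L v
  letI : Fintype 𝓀[(v.adicCompletion ↥(maximalRealSubfield L))] := Fintype.ofFinite _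
  have hchar : ringChar 𝓀[(v.adicCompletion ↥(maximalRealSubfield L))] ≠ 2 := by
    intro h
    have h2' : red (2 : (v.adicCompletion ↥(maximalRealSubfield L))) ≠ 0 := red_ne_zero_of_valuation_eq_one ((v_eq_one_iff_valuation_eq_one _).1 h2)
    rw [red_two] at h2'
    apply h2'
    have h' : ((ringChar 𝓀[(v.adicCompletion ↥(maximalRealSubfield L))] : ℕ) : 𝓀[(v.adicCompletion ↥(maximalRealSubfield L))]) = 0 := ringChar.Nat.cast_ringChar
    rw [h] at h'
    exact_mod_cast h'
  set p' : 𝒪[(v.adicCompletion ↥(maximalRealSubfield L))] := ⟨p, (Valuation.mem_integer_iff _ _).2 hp.le⟩ with hp'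
  set n' : 𝒪[(v.adicCompletion ↥(maximalRealSubfield L))] := ⟨ν, (Valuation.mem_integer_iff _ _).2 hν.le⟩ with hn'
  have hpbar : IsLocalRing.residue 𝒪[(v.adicCompletion ↥(maximalRealSubfield L))] p' ≠ 0 := by
    have : red p ≠ 0 := red_ne_zero_of_valuation_eq_one hp
    rwa [show p = ((p' : 𝒪[(v.adicCompletion ↥(maximalRealSubfield L))]) : (v.adicCompletion ↥(maximalRealSubfield L))) from rfl, red_coe] at this
  have hnbar : IsLocalRing.residue 𝒪[(v.adicCompletion ↥(maximalRealSubfield L))] n' ≠ 0 := by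
    have : red ν ≠ 0 := red_ne_zero_of_valuation_eq_one hν
    rwa [show ν = ((n' : 𝒪[(v.adicCompletion ↥(maximalRealSubfield L))]) : (v.adicCompletion ↥(maximalRealSubfield L))) from rfl, red_coe] at this
  -- a unit `a ∈ 𝒪` from a residue `ā` with `ā² = t̄`, `t` a unit: `|a| = 1` and `|a² − t| < 1`
  have lift : ∀ (tgt : 𝒪[(v.adicCompletion ↥(maximalRealSubfield L))]) (abar : 𝓀[(v.adicCompletion ↥(maximalRealSubfield L))]),
      IsLocalRing.residue 𝒪[(v.adicCompletion ↥(maximalRealSubfield L))] tgt ≠ 0 →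
      abar ^ 2 = IsLocalRing.residue 𝒪[(v.adicCompletion ↥(maximalRealSubfield L))] tgt →
      ∃ a : (v.adicCompletion ↥(maximalRealSubfield L)), valuation (v.adicCompletion ↥(maximalRealSubfield L)) a = 1 ∧
        valuation (v.adicCompletion ↥(maximalRealSubfield L)) (a ^ 2 - (tgt : (v.adicCompletion ↥(maximalRealSubfield L)))) < 1 := by
    intro tgt abar htgt hab
    obtain ⟨a, ha⟩ := IsLocalRing.residue_surjective abar
    refine ⟨a, ?_, ?_⟩
    · refine valuation_eq_one_of_red_ne_zero a.2 ?_
      rw [red_coe, ha]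
      rintro h0
      rw [h0, zero_pow two_ne_zero] at hab
      exact htgt hab.symm
    · have hcoe : (a : (v.adicCompletion ↥(maximalRealSubfield L))) ^ 2 - (tgt : (v.adicCompletion ↥(maximalRealSubfield L))) = (((a ^ 2 - tgt : 𝒪[(v.adicCompletion ↥(maximalRealSubfield L))])) : (v.adicCompletion ↥(maximalRealSubfield L))) := by
        push_cast; rfl
      rw [hcoe]
      refine valuation_lt_one_of_residue_eq_zero L v _ ?_
      rw [map_sub, map_pow, ha, hab, sub_self]
  by_cases hsq : IsSquare (IsLocalRing.residue 𝒪[(v.adicCompletion ↥(maximalRealSubfield L))] p')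
  · obtain ⟨r, hr⟩ := hsq
    obtain ⟨a, ha, hlt⟩ := lift p' r hpbar (by rw [sq, ← hr])
    exact ⟨a, ha, Or.inl hlt⟩
  · -- both `p̄` and `n̄` are non-squares, so `p̄ n̄ = ē²`; lift `ē` to `a` (`a² ≡ pν`) and take `a∕ν`
    have hnsq : ¬ IsSquare (IsLocalRing.residue 𝒪[(v.adicCompletion ↥(maximalRealSubfield L))] n') := by
      rintro ⟨r, hr⟩
      obtain ⟨b, hb⟩ := IsLocalRing.residue_surjective r
      have h1 := hns b b.2
      have hcoe : (b : (v.adicCompletion ↥(maximalRealSubfield L))) ^ 2 - ν = (((b ^ 2 - n' : 𝒪[(v.adicCompletion ↥(maximalRealSubfield L))])) : (v.adicCompletion ↥(maximalRealSubfield L))) := by push_cast; rfl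
      have h2 : valuation (v.adicCompletion ↥(maximalRealSubfield L)) ((b : (v.adicCompletion ↥(maximalRealSubfield L))) ^ 2 - ν) < 1 := by
        rw [hcoe]
        refine valuation_lt_one_of_residue_eq_zero L v _ ?_
        rw [map_sub, map_pow, hb, hr, sq, sub_self]
      exact absurd h1 h2.ne
    have hp1 := (FiniteField.pow_dichotomy hchar hpbar).resolve_left (fun h => hsq ((FiniteField.isSquare_iff hchar hpbar).2 h))
    have hn1 := (FiniteField.pow_dichotomy hchar hnbar).resolve_left (fun h => hnsq ((FiniteField.isSquare_iff hchar hnbar).2 h))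
    have hprod : IsSquare (IsLocalRing.residue 𝒪[(v.adicCompletion ↥(maximalRealSubfield L))] (p' * n')) := by
      rw [map_mul, FiniteField.isSquare_iff hchar (mul_ne_zero hpbar hnbar), mul_pow, hp1, hn1]; ring
    obtain ⟨e, he⟩ := hprod
    obtain ⟨a, ha, hlt⟩ := lift (p' * n') e (by rw [map_mul]; exact mul_ne_zero hpbar hnbar) (by rw [sq, ← he])
    have hν0 : ν ≠ 0 := fun h0 => by rw [h0, map_zero] at hν; exact zero_ne_one hν
    refine ⟨a * ν⁻¹, by rw [map_mul, map_inv₀, ha, hν, inv_one, mul_one], Or.inr ?_⟩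
    have e1 : (a * ν⁻¹) ^ 2 * ν - p = ν⁻¹ * (a ^ 2 - p * ν) := by field_simp
    rw [e1, map_mul, map_inv₀, hν, inv_one, one_mul]
    exact hlt

end Residue

section Scalar

variable {F E : Type*} [Field F] [Field E] (ι : F →+* E) (σ : E →+* E)

/-- **Rescaling a similitude by a `σ`-fixed scalar**: if `ᵗσ(X)JX = μ·J` and `σ(ιa) = ιa` then `ᵗσ(ιa·X)J(ιa·X) = (ι(a²)μ)·J`. [cite: Rogawski1990, §4.9 p. 55] -/
theorem smul_similitude (hσι : ∀ x : F, σ (ι x) = ι x) {J X : Matrix (Fin 2) (Fin 2) E} {μ : E} (hX : (X.map σ)ᵀ * J * X = μ • J) (a : F) :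
    ((ι a • X).map σ)ᵀ * J * (ι a • X) = (ι (a ^ 2) * μ) • J := by
  rw [Matrix.map_smul' σ (ι a) X (map_mul σ), hσι, Matrix.transpose_smul, Matrix.smul_mul, Matrix.smul_mul, Matrix.mul_smul, hX, smul_smul, smul_smul, map_pow]
  ring_nf

end Scalar

/-! ## §2 The odd-depth flip -/

section Flip

variable (L : Type) [Field L] [NumberField L] [IsCMField L] (v : HeightOneSpectrum (𝓞 ↥(maximalRealSubfield L)))
  (w : PlacesOver L v) (hw : IsCMField.complexConj L • w.1 = w.1)

set_option maxHeartbeats 800000 in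
include hw in
/-- **THE ODD-DEPTH CLASS-FLIPPING SIMILITUDE.**  For a type-(2) `u ∈ U(σ_w, Φ₂)(L_w)` (no root of `χ_u` in `L_w`) with (W1) descent `D_ϖ u D_ϖ⁻¹ = s·ι(g)` and
`tr²g − 4det g = π₁z²`, `|π₁|_v = |ϖ_{L⁺}|_v` (ODD depth), `z ≠ 0`, `|2|_v = 1`: there are `X₀ ∈ GL₂(L_w)` and a unit `ν ∈ L⁺_v` of NON-SQUARE residue (`|y² − ν|_v = 1` on `𝒪_v`)
with `ᵗσ_w(X₀)·J·X₀ = ι(ν)·J`, `X₀u = uX₀`, and `X₀hX₀⁻¹ ∈ U` for all `h ∈ U` — namely `X₀ = ι(2∕(zπ₀))·ϖ·D_ϖ⁻¹·ι(g − ½t·1)·D_ϖ`, `ν = π₁∕π₀` (`ι(π₀) = ϖ²`); `ν` is a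
non-square since otherwise `χ_u` would have the root `½(tr u + sϖ·ι(bz))`. [cite: LabesseLanglands1979, §2 pp. 7–8] [cite: Rogawski1990, §4.9 p. 55] [cite: Serre1979, Ch. XIV §4] -/
theorem exists_classFlip_similitude_odd (he : v.asIdeal.ramificationIdx' w.1.asIdeal ≠ 1) (h2v : Valued.v (2 : (v.adicCompletion ↥(maximalRealSubfield L))) = 1)
    (ϖ : (w.1.adicCompletion L)ˣ) (hϖ : Valued.v (ϖ : (w.1.adicCompletion L)) = WithZero.exp (-1 : ℤ))
    (hσϖ : galAdicCompletionMap (L := L) (IsCMField.complexConj L) hw (ϖ : (w.1.adicCompletion L)) = -(ϖ : (w.1.adicCompletion L)))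
    (u : ↥(unitaryGroupOfForm (galAdicCompletionMap (L := L) (IsCMField.complexConj L) hw) (placeForm (Matrix.of fun i j : Fin 2 => if i.val + j.val + 1 = 2 then (1 : L) else 0) w.1)))
    (hirr : ¬ ∃ x : (w.1.adicCompletion L), (((u : GL (Fin 2) (w.1.adicCompletion L)) : Matrix (Fin 2) (Fin 2) (w.1.adicCompletion L)).charpoly).IsRoot x)
    {s : (w.1.adicCompletion L)} {g : GL (Fin 2) (v.adicCompletion ↥(maximalRealSubfield L))}
    (hsg : Matrix.diagonal ![1, (ϖ : (w.1.adicCompletion L))] * ((u : GL (Fin 2) (w.1.adicCompletion L)) : Matrix (Fin 2) (Fin 2) (w.1.adicCompletion L)) * Matrix.diagonal ![1, (ϖ : (w.1.adicCompletion L))⁻¹] =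
      s • (g : Matrix (Fin 2) (Fin 2) (v.adicCompletion ↥(maximalRealSubfield L))).map (toPlace v w))
    {π₁ z : (v.adicCompletion ↥(maximalRealSubfield L))} (hπ₁ : Valued.v π₁ = WithZero.exp (-1 : ℤ)) (hz : z ≠ 0)
    (hD : (g : Matrix (Fin 2) (Fin 2) (v.adicCompletion ↥(maximalRealSubfield L))).trace ^ 2 - 4 * (g : Matrix (Fin 2) (Fin 2) (v.adicCompletion ↥(maximalRealSubfield L))).det = π₁ * z ^ 2) :
    ∃ (X₀ : GL (Fin 2) (w.1.adicCompletion L)) (ν : (v.adicCompletion ↥(maximalRealSubfield L))),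
      ((X₀ : Matrix (Fin 2) (Fin 2) (w.1.adicCompletion L)).map (galAdicCompletionMap (L := L) (IsCMField.complexConj L) hw))ᵀ * !![(0 : (w.1.adicCompletion L)), 1; 1, 0] * (X₀ : Matrix (Fin 2) (Fin 2) (w.1.adicCompletion L)) =
          toPlace v w ν • !![(0 : (w.1.adicCompletion L)), 1; 1, 0] ∧
      valuation (v.adicCompletion ↥(maximalRealSubfield L)) ν = 1 ∧
      (∀ y : (v.adicCompletion ↥(maximalRealSubfield L)), y ∈ 𝒪[(v.adicCompletion ↥(maximalRealSubfield L))] → valuation (v.adicCompletion ↥(maximalRealSubfield L)) (y ^ 2 - ν) = 1) ∧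
      (X₀ : Matrix (Fin 2) (Fin 2) (w.1.adicCompletion L)) * ((u : GL (Fin 2) (w.1.adicCompletion L)) : Matrix (Fin 2) (Fin 2) (w.1.adicCompletion L)) = ((u : GL (Fin 2) (w.1.adicCompletion L)) : Matrix (Fin 2) (Fin 2) (w.1.adicCompletion L)) * (X₀ : Matrix (Fin 2) (Fin 2) (w.1.adicCompletion L)) ∧
      ∀ h : GL (Fin 2) (w.1.adicCompletion L), h ∈ unitaryGroupOfForm (galAdicCompletionMap (L := L) (IsCMField.complexConj L) hw) (placeForm (Matrix.of fun i j : Fin 2 => if i.val + j.val + 1 = 2 then (1 : L) else 0) w.1) →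
        X₀ * h * X₀⁻¹ ∈ unitaryGroupOfForm (galAdicCompletionMap (L := L) (IsCMField.complexConj L) hw) (placeForm (Matrix.of fun i j : Fin 2 => if i.val + j.val + 1 = 2 then (1 : L) else 0) w.1) := by
  have hϖ0 : (ϖ : (w.1.adicCompletion L)) ≠ 0 := ϖ.ne_zero
  obtain ⟨h2w, h2w0⟩ := valued_two_eq_one_of_ramified L v w hw he h2v
  have h2F0 : (2 : (v.adicCompletion ↥(maximalRealSubfield L))) ≠ 0 := fun h0 => zero_ne_one (by rw [h0, map_zero] at h2v; exact h2v)
  have hσι : ∀ x, galAdicCompletionMap (L := L) (IsCMField.complexConj L) hw (toPlace v w x) = toPlace v w x :=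
    fun x => galAdicCompletionMap_toPlace (IsCMField.complexConj L) w w hw x
  -- `ϖ² = ι(π₀)`, `|π₀|_v = |π₁|_v = exp(−1)`
  obtain ⟨π₀, hπ₀⟩ := exists_toPlace_eq_of_galAdicCompletionMap_eq (IsCMField.complexConj L) w (IsCMField.complexConj_ne_one L) hw ((ϖ : (w.1.adicCompletion L)) ^ 2)
    (by rw [map_pow, hσϖ, neg_sq])
  have hπ₀v : Valued.v π₀ = WithZero.exp (-1 : ℤ) := by
    have h1 : Valued.v (toPlace v w π₀) = WithZero.exp (-1 : ℤ) ^ 2 := by rw [hπ₀, map_pow, hϖ]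
    rw [valued_toPlace_eq_sq_of_ramified L v w hw he] at h1
    have hπ00 : π₀ ≠ 0 := fun h0 => by
      rw [h0, map_zero, zero_pow two_ne_zero] at h1
      exact (pow_ne_zero 2 WithZero.coe_ne_zero) h1.symm
    obtain ⟨m, hm⟩ : ∃ m : ℤ, Valued.v π₀ = WithZero.exp m := ⟨_, (WithZero.exp_log ((Valuation.ne_zero_iff _).2 hπ00)).symm⟩
    rw [hm, ← WithZero.exp_nsmul, ← WithZero.exp_nsmul, WithZero.exp_inj] at h1
    simp only [nsmul_eq_mul, Nat.cast_ofNat] at h1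
    rw [hm, show m = -1 by omega]
  have hπ00 : π₀ ≠ 0 := fun h0 => by rw [h0, map_zero] at hπ₀v; exact WithZero.coe_ne_zero hπ₀v.symm
  have hπ10 : π₁ ≠ 0 := fun h0 => by rw [h0, map_zero] at hπ₁; exact WithZero.coe_ne_zero hπ₁.symm
  have hνv : Valued.v (π₁ / π₀) = 1 := by rw [map_div₀, hπ₁, hπ₀v, div_self WithZero.coe_ne_zero]
  have hν : valuation (v.adicCompletion ↥(maximalRealSubfield L)) (π₁ / π₀) = 1 := (v_eq_one_iff_valuation_eq_one _).1 hνv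
  -- the traceless part `τ = g − ½t·1`, `det τ = −¼π₁z²`
  set t : (v.adicCompletion ↥(maximalRealSubfield L)) := (g : Matrix (Fin 2) (Fin 2) (v.adicCompletion ↥(maximalRealSubfield L))).trace with htdef
  set τ : Matrix (Fin 2) (Fin 2) (v.adicCompletion ↥(maximalRealSubfield L)) := (g : Matrix (Fin 2) (Fin 2) (v.adicCompletion ↥(maximalRealSubfield L))) - (t / 2) • (1 : Matrix (Fin 2) (Fin 2) (v.adicCompletion ↥(maximalRealSubfield L))) with hτdef
  have hdetτ : τ.det = -(π₁ * z ^ 2) / 4 := by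
    have e : τ.det = (g : Matrix (Fin 2) (Fin 2) (v.adicCompletion ↥(maximalRealSubfield L))).det - t ^ 2 / 4 := by
      rw [hτdef, htdef, Matrix.det_fin_two, Matrix.det_fin_two, Matrix.trace_fin_two]
      simp only [Matrix.sub_apply, Matrix.smul_apply, Matrix.one_apply_eq, Matrix.one_apply_ne (show (0 : Fin 2) ≠ 1 by decide),
        Matrix.one_apply_ne (show (1 : Fin 2) ≠ 0 by decide), smul_eq_mul, mul_one, mul_zero, sub_zero]
      ring
    rw [e, show (g : Matrix (Fin 2) (Fin 2) (v.adicCompletion ↥(maximalRealSubfield L))).det = (t ^ 2 - π₁ * z ^ 2) / 4 by rw [← hD, htdef]; ring]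
    ring
  have hdetτ0 : τ.det ≠ 0 := by
    rw [hdetτ]
    exact div_ne_zero (neg_ne_zero.2 (mul_ne_zero hπ10 (pow_ne_zero _ hz))) (by rw [show (4 : (v.adicCompletion ↥(maximalRealSubfield L))) = 2 * 2 by norm_num]; exact mul_ne_zero h2F0 h2F0)
  have hcomm : τ * (g : Matrix (Fin 2) (Fin 2) (v.adicCompletion ↥(maximalRealSubfield L))) = (g : Matrix (Fin 2) (Fin 2) (v.adicCompletion ↥(maximalRealSubfield L))) * τ := by
    rw [hτdef, Matrix.sub_mul, Matrix.mul_sub, Matrix.smul_mul, Matrix.mul_smul, Matrix.one_mul, Matrix.mul_one]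
  -- `X = λ • D⁻¹ ι(τ) D`, `λ = ι(2∕(zπ₀))·ϖ`
  set lam : (w.1.adicCompletion L) := toPlace v w (2 / (z * π₀)) * (ϖ : (w.1.adicCompletion L)) with hlam
  have hlam0 : lam ≠ 0 := mul_ne_zero (by rw [_root_.map_ne_zero]; exact div_ne_zero h2F0 (mul_ne_zero hz hπ00)) hϖ0
  have hσlam : galAdicCompletionMap (L := L) (IsCMField.complexConj L) hw lam * lam = toPlace v w (-((2 / (z * π₀)) ^ 2 * π₀)) := by
    rw [hlam, map_mul, hσι, hσϖ, map_neg, map_mul, map_pow, hπ₀]; ring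
  set M : Matrix (Fin 2) (Fin 2) (w.1.adicCompletion L) := Matrix.diagonal ![1, (ϖ : (w.1.adicCompletion L))⁻¹] * τ.map (toPlace v w) * Matrix.diagonal ![1, (ϖ : (w.1.adicCompletion L))] with hMdef
  have hsimM := formCongr_conj_diagonal_map (toPlace v w) (galAdicCompletionMap (L := L) (IsCMField.complexConj L) hw) hσι hσϖ hϖ0 τ
  set X : Matrix (Fin 2) (Fin 2) (w.1.adicCompletion L) := lam • M with hXdef
  have hsimX : (X.map (galAdicCompletionMap (L := L) (IsCMField.complexConj L) hw))ᵀ * !![(0 : (w.1.adicCompletion L)), 1; 1, 0] * X = toPlace v w (π₁ / π₀) • !![(0 : (w.1.adicCompletion L)), 1; 1, 0] := by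
    rw [hXdef, Matrix.map_smul' _ lam M (map_mul _), Matrix.transpose_smul, Matrix.smul_mul, Matrix.smul_mul, Matrix.mul_smul, hMdef, hsimM, smul_smul, smul_smul, hσlam,
      ← map_mul, hdetτ]
    congr 1
    congr 1
    field_simp
    ring
  have hXdet : X.det ≠ 0 := by
    rw [hXdef, Matrix.det_smul, hMdef, Matrix.det_mul, Matrix.det_mul, ← RingHom.mapMatrix_apply, ← RingHom.map_det, Matrix.det_diagonal, Matrix.det_diagonal]
    simp [Fin.prod_univ_two, hϖ0, hdetτ0, hlam0]
  set X₀ : GL (Fin 2) (w.1.adicCompletion L) := Matrix.GeneralLinearGroup.mk'' X (isUnit_iff_ne_zero.2 hXdet) with hX₀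
  have hX₀coe : (X₀ : Matrix (Fin 2) (Fin 2) (w.1.adicCompletion L)) = X := rfl
  -- `u = D⁻¹ (s ι g) D`
  have hDD := diagonal_inv_mul_diagonal (E := (w.1.adicCompletion L)) hϖ0
  have hDD' := diagonal_mul_diagonal_inv (E := (w.1.adicCompletion L)) hϖ0
  have huv : ((u : GL (Fin 2) (w.1.adicCompletion L)) : Matrix (Fin 2) (Fin 2) (w.1.adicCompletion L)) = Matrix.diagonal ![1, (ϖ : (w.1.adicCompletion L))⁻¹] * (s • (g : Matrix (Fin 2) (Fin 2) (v.adicCompletion ↥(maximalRealSubfield L))).map (toPlace v w)) * Matrix.diagonal ![1, (ϖ : (w.1.adicCompletion L))] := by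
    rw [← hsg]
    calc ((u : GL (Fin 2) (w.1.adicCompletion L)) : Matrix (Fin 2) (Fin 2) (w.1.adicCompletion L))
        = (Matrix.diagonal ![1, (ϖ : (w.1.adicCompletion L))⁻¹] * Matrix.diagonal ![1, (ϖ : (w.1.adicCompletion L))]) * ((u : GL (Fin 2) (w.1.adicCompletion L)) : Matrix (Fin 2) (Fin 2) (w.1.adicCompletion L)) *
            (Matrix.diagonal ![1, (ϖ : (w.1.adicCompletion L))⁻¹] * Matrix.diagonal ![1, (ϖ : (w.1.adicCompletion L))]) := by rw [hDD, Matrix.one_mul, Matrix.mul_one]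
      _ = _ := by simp only [Matrix.mul_assoc]
  -- NON-SQUARE residue of `ν = π₁∕π₀`: else `χ_u` has a root in `L_w`
  obtain ⟨htru, hdetu⟩ := trace_and_det_of_descent (toPlace v w) hϖ0 hsg
  have hns : ∀ y : (v.adicCompletion ↥(maximalRealSubfield L)), y ∈ 𝒪[(v.adicCompletion ↥(maximalRealSubfield L))] → valuation (v.adicCompletion ↥(maximalRealSubfield L)) (y ^ 2 - π₁ / π₀) = 1 := by
    intro y hy
    have hy1 : Valued.v y ≤ 1 := (v_le_one_iff_valuation_le_one y).2 ((Valuation.mem_integer_iff _ _).1 hy)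
    have hle : Valued.v (y ^ 2 - π₁ / π₀) ≤ 1 := by
      refine le_trans (Valuation.map_sub _ _ _) (max_le ?_ hνv.le)
      rw [map_pow, ← one_pow 2]; exact pow_le_pow_left₀ zero_le hy1 2
    rw [← v_eq_one_iff_valuation_eq_one]
    refine le_antisymm hle (not_lt.1 fun hlt => hirr ?_)
    -- `|y² − ν| < 1`: `|y| = 1`, `ν∕y²` is a one-unit, hence a square `r²`; `ν = (ry)² =: b²`
    have hy2 : Valued.v (y ^ 2) = 1 := by
      have e : y ^ 2 = π₁ / π₀ + (y ^ 2 - π₁ / π₀) := by ring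
      rw [e, Valuation.map_add_eq_of_lt_left _ (by rw [hνv]; exact hlt), hνv]
    have hy0 : y ≠ 0 := fun h0 => by rw [h0, zero_pow two_ne_zero, map_zero] at hy2; exact zero_ne_one hy2
    have hone : Valued.v (π₁ / π₀ / y ^ 2 - 1) < 1 := by
      rw [show π₁ / π₀ / y ^ 2 - 1 = -((y ^ 2 - π₁ / π₀) / y ^ 2) by field_simp; ring, Valuation.map_neg, map_div₀, hy2, div_one]
      exact hlt
    obtain ⟨r, hr2, -⟩ := exists_sq_eq_of_valued_sub_one_lt v h2v _ hone
    set b : (v.adicCompletion ↥(maximalRealSubfield L)) := r * y with hb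
    have hb2 : π₁ = π₀ * b ^ 2 := by
      rw [hb, mul_pow, hr2]; field_simp
    -- the root `x = ½ (tr u + s ϖ ι(bz))`
    set yy : (w.1.adicCompletion L) := s * (ϖ : (w.1.adicCompletion L)) * toPlace v w (b * z) with hyy
    have hdisc : ((u : GL (Fin 2) (w.1.adicCompletion L)) : Matrix (Fin 2) (Fin 2) (w.1.adicCompletion L)).trace ^ 2 -
        4 * ((u : GL (Fin 2) (w.1.adicCompletion L)) : Matrix (Fin 2) (Fin 2) (w.1.adicCompletion L)).det = yy * yy := by
      rw [htru, hdetu, hyy]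
      have e1 : (s * toPlace v w (g : Matrix (Fin 2) (Fin 2) (v.adicCompletion ↥(maximalRealSubfield L))).trace) ^ 2 - 4 * (s ^ 2 * toPlace v w (g : Matrix (Fin 2) (Fin 2) (v.adicCompletion ↥(maximalRealSubfield L))).det) =
          s ^ 2 * toPlace v w ((g : Matrix (Fin 2) (Fin 2) (v.adicCompletion ↥(maximalRealSubfield L))).trace ^ 2 - 4 * (g : Matrix (Fin 2) (Fin 2) (v.adicCompletion ↥(maximalRealSubfield L))).det) := by
        rw [map_sub, map_mul, map_pow, map_ofNat]; ring
      rw [e1, hD, hb2, show π₀ * b ^ 2 * z ^ 2 = π₀ * (b * z) ^ 2 by ring, map_mul, map_pow, hπ₀]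
      ring
    refine ⟨(((u : GL (Fin 2) (w.1.adicCompletion L)) : Matrix (Fin 2) (Fin 2) (w.1.adicCompletion L)).trace + yy) / 2, ?_⟩
    rw [Matrix.charpoly_fin_two, Polynomial.IsRoot.def]
    simp only [eval_add, eval_sub, eval_mul, eval_pow, eval_C, eval_X]
    have h4 : (4 : (w.1.adicCompletion L)) ≠ 0 := by rw [show (4 : (w.1.adicCompletion L)) = 2 * 2 by norm_num]; exact mul_ne_zero h2w0 h2w0
    set ν2 : (w.1.adicCompletion L) := (2 : (w.1.adicCompletion L))⁻¹ with hν2def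
    have hν2 : ν2 * 2 = 1 := inv_mul_cancel₀ h2w0
    rw [div_eq_mul_inv, ← hν2def]
    have key : (4 : (w.1.adicCompletion L)) * (((((u : GL (Fin 2) (w.1.adicCompletion L)) : Matrix (Fin 2) (Fin 2) (w.1.adicCompletion L)).trace + yy) * ν2) ^ 2 -
        ((u : GL (Fin 2) (w.1.adicCompletion L)) : Matrix (Fin 2) (Fin 2) (w.1.adicCompletion L)).trace * ((((u : GL (Fin 2) (w.1.adicCompletion L)) : Matrix (Fin 2) (Fin 2) (w.1.adicCompletion L)).trace + yy) * ν2) +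
        ((u : GL (Fin 2) (w.1.adicCompletion L)) : Matrix (Fin 2) (Fin 2) (w.1.adicCompletion L)).det) = 0 := by
      linear_combination ((((u : GL (Fin 2) (w.1.adicCompletion L)) : Matrix (Fin 2) (Fin 2) (w.1.adicCompletion L)).trace + yy) ^ 2 * (2 * ν2 + 1) -
        2 * ((u : GL (Fin 2) (w.1.adicCompletion L)) : Matrix (Fin 2) (Fin 2) (w.1.adicCompletion L)).trace * ((((u : GL (Fin 2) (w.1.adicCompletion L)) : Matrix (Fin 2) (Fin 2) (w.1.adicCompletion L)).trace + yy))) * hν2 +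
        (-1 : (w.1.adicCompletion L)) * hdisc
    exact (mul_eq_zero.1 key).resolve_left h4
  refine ⟨X₀, π₁ / π₀, by rw [hX₀coe]; exact hsimX, hν, hns, ?_, fun h hh => ?_⟩
  · -- commutation
    rw [hX₀coe, hXdef, Matrix.smul_mul, Matrix.mul_smul, hMdef, huv]
    congr 1
    have hιcomm : τ.map (toPlace v w) * (s • (g : Matrix (Fin 2) (Fin 2) (v.adicCompletion ↥(maximalRealSubfield L))).map (toPlace v w)) = (s • (g : Matrix (Fin 2) (Fin 2) (v.adicCompletion ↥(maximalRealSubfield L))).map (toPlace v w)) * τ.map (toPlace v w) := by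
      rw [Matrix.mul_smul, Matrix.smul_mul, ← Matrix.map_mul, hcomm, Matrix.map_mul]
    calc Matrix.diagonal ![1, (ϖ : (w.1.adicCompletion L))⁻¹] * τ.map (toPlace v w) * Matrix.diagonal ![1, (ϖ : (w.1.adicCompletion L))] *
          (Matrix.diagonal ![1, (ϖ : (w.1.adicCompletion L))⁻¹] * (s • (g : Matrix (Fin 2) (Fin 2) (v.adicCompletion ↥(maximalRealSubfield L))).map (toPlace v w)) * Matrix.diagonal ![1, (ϖ : (w.1.adicCompletion L))])
        = Matrix.diagonal ![1, (ϖ : (w.1.adicCompletion L))⁻¹] * (τ.map (toPlace v w) * ((Matrix.diagonal ![1, (ϖ : (w.1.adicCompletion L))] * Matrix.diagonal ![1, (ϖ : (w.1.adicCompletion L))⁻¹]) *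
            (s • (g : Matrix (Fin 2) (Fin 2) (v.adicCompletion ↥(maximalRealSubfield L))).map (toPlace v w)))) * Matrix.diagonal ![1, (ϖ : (w.1.adicCompletion L))] := by simp only [Matrix.mul_assoc]
      _ = Matrix.diagonal ![1, (ϖ : (w.1.adicCompletion L))⁻¹] * ((s • (g : Matrix (Fin 2) (Fin 2) (v.adicCompletion ↥(maximalRealSubfield L))).map (toPlace v w)) * ((Matrix.diagonal ![1, (ϖ : (w.1.adicCompletion L))] * Matrix.diagonal ![1, (ϖ : (w.1.adicCompletion L))⁻¹]) *
            τ.map (toPlace v w))) * Matrix.diagonal ![1, (ϖ : (w.1.adicCompletion L))] := by rw [hDD', Matrix.one_mul, Matrix.one_mul, hιcomm]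
      _ = _ := by simp only [Matrix.mul_assoc]
  · -- conjugation preserves `U`
    rw [unitaryGroupOfForm_placeForm_antidiagTwo_eq] at hh ⊢
    exact conj_mem_unitaryGroupOfForm_of_similitude (galAdicCompletionMap (L := L) (IsCMField.complexConj L) hw) X₀ (by rw [hX₀coe]; exact hsimX) h hh

/-! ## §3 The odd-depth flip with prescribed residual class -/

set_option maxHeartbeats 800000 in
include hw in
/-- **THE ODD-DEPTH CLASS FLIP FOR A PRESCRIBED CLASS.**  Under the hypotheses of `exists_classFlip_similitude_odd` and for ANY unit `c ∈ 𝒪_w` there are `X₀ ∈ GL₂(L_w)` and a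
unit `ν ∈ L⁺_v` with `ᵗσ_w(X₀)·J·X₀ = ι(ν)·J`, `|ι(ν) − c|_w < 1`, `X₀u = uX₀`, `X₀UX₀⁻¹ ⊆ U`: with `c ≡ ι(p)` and the residual dichotomy `p ≡ a²` (`X₀ = ι(a)·1`) or
`p ≡ a²·(π₁∕π₀)` (`X₀ = ι(a)·X`, `X` the odd flip).  The odd-depth twin of ★ 2a `exists_classFlip_similitude_of_unit`. [cite: LabesseLanglands1979, §2 pp. 7–8]
[cite: Rogawski1990, §4.9 p. 55] [cite: Serre1979, Ch. XIV §4] -/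
theorem exists_classFlip_similitude_of_unit_odd (he : v.asIdeal.ramificationIdx' w.1.asIdeal ≠ 1) (h2v : Valued.v (2 : (v.adicCompletion ↥(maximalRealSubfield L))) = 1)
    (ϖ : (w.1.adicCompletion L)ˣ) (hϖ : Valued.v (ϖ : (w.1.adicCompletion L)) = WithZero.exp (-1 : ℤ))
    (hσϖ : galAdicCompletionMap (L := L) (IsCMField.complexConj L) hw (ϖ : (w.1.adicCompletion L)) = -(ϖ : (w.1.adicCompletion L)))
    (u : ↥(unitaryGroupOfForm (galAdicCompletionMap (L := L) (IsCMField.complexConj L) hw) (placeForm (Matrix.of fun i j : Fin 2 => if i.val + j.val + 1 = 2 then (1 : L) else 0) w.1)))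
    (hirr : ¬ ∃ x : (w.1.adicCompletion L), (((u : GL (Fin 2) (w.1.adicCompletion L)) : Matrix (Fin 2) (Fin 2) (w.1.adicCompletion L)).charpoly).IsRoot x)
    {s : (w.1.adicCompletion L)} {g : GL (Fin 2) (v.adicCompletion ↥(maximalRealSubfield L))}
    (hsg : Matrix.diagonal ![1, (ϖ : (w.1.adicCompletion L))] * ((u : GL (Fin 2) (w.1.adicCompletion L)) : Matrix (Fin 2) (Fin 2) (w.1.adicCompletion L)) * Matrix.diagonal ![1, (ϖ : (w.1.adicCompletion L))⁻¹] =
      s • (g : Matrix (Fin 2) (Fin 2) (v.adicCompletion ↥(maximalRealSubfield L))).map (toPlace v w))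
    {π₁ z : (v.adicCompletion ↥(maximalRealSubfield L))} (hπ₁ : Valued.v π₁ = WithZero.exp (-1 : ℤ)) (hz : z ≠ 0)
    (hD : (g : Matrix (Fin 2) (Fin 2) (v.adicCompletion ↥(maximalRealSubfield L))).trace ^ 2 - 4 * (g : Matrix (Fin 2) (Fin 2) (v.adicCompletion ↥(maximalRealSubfield L))).det = π₁ * z ^ 2)
    {c : (w.1.adicCompletion L)} (hc : Valued.v c = 1) :
    ∃ (X₀ : GL (Fin 2) (w.1.adicCompletion L)) (ν : (v.adicCompletion ↥(maximalRealSubfield L))),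
      ((X₀ : Matrix (Fin 2) (Fin 2) (w.1.adicCompletion L)).map (galAdicCompletionMap (L := L) (IsCMField.complexConj L) hw))ᵀ * !![(0 : (w.1.adicCompletion L)), 1; 1, 0] * (X₀ : Matrix (Fin 2) (Fin 2) (w.1.adicCompletion L)) =
          toPlace v w ν • !![(0 : (w.1.adicCompletion L)), 1; 1, 0] ∧
      valuation (v.adicCompletion ↥(maximalRealSubfield L)) ν = 1 ∧ Valued.v (toPlace v w ν - c) < 1 ∧
      (X₀ : Matrix (Fin 2) (Fin 2) (w.1.adicCompletion L)) * ((u : GL (Fin 2) (w.1.adicCompletion L)) : Matrix (Fin 2) (Fin 2) (w.1.adicCompletion L)) = ((u : GL (Fin 2) (w.1.adicCompletion L)) : Matrix (Fin 2) (Fin 2) (w.1.adicCompletion L)) * (X₀ : Matrix (Fin 2) (Fin 2) (w.1.adicCompletion L)) ∧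
      ∀ h : GL (Fin 2) (w.1.adicCompletion L), h ∈ unitaryGroupOfForm (galAdicCompletionMap (L := L) (IsCMField.complexConj L) hw) (placeForm (Matrix.of fun i j : Fin 2 => if i.val + j.val + 1 = 2 then (1 : L) else 0) w.1) →
        X₀ * h * X₀⁻¹ ∈ unitaryGroupOfForm (galAdicCompletionMap (L := L) (IsCMField.complexConj L) hw) (placeForm (Matrix.of fun i j : Fin 2 => if i.val + j.val + 1 = 2 then (1 : L) else 0) w.1) := by
  have hσι : ∀ x, galAdicCompletionMap (L := L) (IsCMField.complexConj L) hw (toPlace v w x) = toPlace v w x :=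
    fun x => galAdicCompletionMap_toPlace (IsCMField.complexConj L) w w hw x
  obtain ⟨p, hp, hpc⟩ := exists_toPlace_unit_near L v w hw he hϖ hc
  obtain ⟨X₁, ν₁, hsim₁, hν₁, hns₁, hcomm₁, hnorm₁⟩ := exists_classFlip_similitude_odd L v w hw he h2v ϖ hϖ hσϖ u hirr hsg hπ₁ hz hD
  obtain ⟨a, ha, hcase⟩ := exists_unit_sq_or_sq_mul_near L v h2v hν₁ hns₁ hp
  have ha1 : Valued.v a = 1 := (v_eq_one_iff_valuation_eq_one _).2 ha
  have ha0 : toPlace v w a ≠ 0 := by rw [_root_.map_ne_zero]; exact fun h0 => by rw [h0, map_zero] at ha1; exact zero_ne_one ha1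
  -- the two candidate similitudes `ι(a)·1` and `ι(a)·X₁`, uniformly: `Y` a similitude of multiplier `ι(μ)` commuting with `u`, normalising `U`
  have build : ∀ (Y : GL (Fin 2) (w.1.adicCompletion L)) (μ : (v.adicCompletion ↥(maximalRealSubfield L))),
      ((Y : Matrix (Fin 2) (Fin 2) (w.1.adicCompletion L)).map (galAdicCompletionMap (L := L) (IsCMField.complexConj L) hw))ᵀ * !![(0 : (w.1.adicCompletion L)), 1; 1, 0] * (Y : Matrix (Fin 2) (Fin 2) (w.1.adicCompletion L)) =
          toPlace v w μ • !![(0 : (w.1.adicCompletion L)), 1; 1, 0] →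
      valuation (v.adicCompletion ↥(maximalRealSubfield L)) μ = 1 → valuation (v.adicCompletion ↥(maximalRealSubfield L)) (a ^ 2 * μ - p) < 1 →
      (Y : Matrix (Fin 2) (Fin 2) (w.1.adicCompletion L)) * ((u : GL (Fin 2) (w.1.adicCompletion L)) : Matrix (Fin 2) (Fin 2) (w.1.adicCompletion L)) = ((u : GL (Fin 2) (w.1.adicCompletion L)) : Matrix (Fin 2) (Fin 2) (w.1.adicCompletion L)) * (Y : Matrix (Fin 2) (Fin 2) (w.1.adicCompletion L)) →
      ∃ (X₀ : GL (Fin 2) (w.1.adicCompletion L)) (ν : (v.adicCompletion ↥(maximalRealSubfield L))),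
        ((X₀ : Matrix (Fin 2) (Fin 2) (w.1.adicCompletion L)).map (galAdicCompletionMap (L := L) (IsCMField.complexConj L) hw))ᵀ * !![(0 : (w.1.adicCompletion L)), 1; 1, 0] * (X₀ : Matrix (Fin 2) (Fin 2) (w.1.adicCompletion L)) =
            toPlace v w ν • !![(0 : (w.1.adicCompletion L)), 1; 1, 0] ∧
        valuation (v.adicCompletion ↥(maximalRealSubfield L)) ν = 1 ∧ Valued.v (toPlace v w ν - c) < 1 ∧
        (X₀ : Matrix (Fin 2) (Fin 2) (w.1.adicCompletion L)) * ((u : GL (Fin 2) (w.1.adicCompletion L)) : Matrix (Fin 2) (Fin 2) (w.1.adicCompletion L)) = ((u : GL (Fin 2) (w.1.adicCompletion L)) : Matrix (Fin 2) (Fin 2) (w.1.adicCompletion L)) * (X₀ : Matrix (Fin 2) (Fin 2) (w.1.adicCompletion L)) ∧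
        ∀ h : GL (Fin 2) (w.1.adicCompletion L), h ∈ unitaryGroupOfForm (galAdicCompletionMap (L := L) (IsCMField.complexConj L) hw) (placeForm (Matrix.of fun i j : Fin 2 => if i.val + j.val + 1 = 2 then (1 : L) else 0) w.1) →
          X₀ * h * X₀⁻¹ ∈ unitaryGroupOfForm (galAdicCompletionMap (L := L) (IsCMField.complexConj L) hw) (placeForm (Matrix.of fun i j : Fin 2 => if i.val + j.val + 1 = 2 then (1 : L) else 0) w.1) := by
    intro Y μ hY hμ hlt hYu
    have hsim := smul_similitude (toPlace v w) (galAdicCompletionMap (L := L) (IsCMField.complexConj L) hw) hσι hY a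
    rw [← map_mul] at hsim
    have hdet : (toPlace v w a • (Y : Matrix (Fin 2) (Fin 2) (w.1.adicCompletion L))).det ≠ 0 := by
      rw [Matrix.det_smul, Fintype.card_fin]
      exact mul_ne_zero (pow_ne_zero _ ha0) (Matrix.GeneralLinearGroup.det_ne_zero Y)
    set X₀ : GL (Fin 2) (w.1.adicCompletion L) := Matrix.GeneralLinearGroup.mk'' _ (isUnit_iff_ne_zero.2 hdet) with hX₀
    have hX₀coe : (X₀ : Matrix (Fin 2) (Fin 2) (w.1.adicCompletion L)) = toPlace v w a • (Y : Matrix (Fin 2) (Fin 2) (w.1.adicCompletion L)) := rfl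
    refine ⟨X₀, a ^ 2 * μ, by rw [hX₀coe]; exact hsim, ?_, ?_, ?_, fun h hh => ?_⟩
    · rw [map_mul, map_pow, ha, one_pow, one_mul, hμ]
    · rw [show toPlace v w (a ^ 2 * μ) - c = toPlace v w (a ^ 2 * μ - p) + (toPlace v w p - c) by rw [map_sub]; ring]
      refine lt_of_le_of_lt (Valuation.map_add _ _ _) (max_lt ?_ hpc)
      rw [valued_toPlace_eq_sq_of_ramified L v w hw he, ← one_pow 2]
      exact pow_lt_pow_left₀ ((v_lt_one_iff_valuation_lt_one _).2 hlt) zero_le two_ne_zero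
    · rw [hX₀coe, Matrix.smul_mul, Matrix.mul_smul, hYu]
    · rw [unitaryGroupOfForm_placeForm_antidiagTwo_eq] at hh ⊢
      exact conj_mem_unitaryGroupOfForm_of_similitude (galAdicCompletionMap (L := L) (IsCMField.complexConj L) hw) X₀ (by rw [hX₀coe]; exact hsim) h hh
  rcases hcase with hlt | hlt
  · -- `p ≡ a²`: the scalar `ι(a)·1`
    refine build 1 1 ?_ (by rw [map_one]) (by rw [mul_one]; exact hlt) (by rw [Units.val_one, Matrix.one_mul, Matrix.mul_one])
    rw [Units.val_one, Matrix.map_one _ (map_zero _) (map_one _), Matrix.transpose_one, Matrix.one_mul, Matrix.mul_one, map_one, one_smul]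
  · -- `p ≡ a²ν₁`: the scalar multiple `ι(a)·X₁` of the odd flip
    exact build X₁ ν₁ hsim₁ hν₁ hlt hcomm₁

end Flip

end Literature.NumberTheory.Automorphic.UnitaryGroup

end
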